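import Summits.Ventures.PercRepro.ProfileGapMonoThresholdFlatBound
import Summits.Ventures.PercRepro.ProfileGapMonoThresholdLongLine

/-!
# PercRepro — THE GENERAL-`q` STRUCTURE OF THE THRESHOLD FAMILY'S OPEN CORE: long flats have series-class
complements, the excess is at most `q − 2` on a coloop-free matroid, and the slack sits on the boundary
(p5, gen 30; `proofs/P5-GM1.md` §40; announced INBOX 13953)

Three general-`q` facts behind the co-rank-`4` census of §40, each a kernel lemma with no hypothesis beyond the
named one.  (a) A rank-`(q−1)` flat `F = cl B` with `ν + q − 2` points on a coloop-free matroid (`2 ≤ q`) has a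
SERIES-CLASS complement `O = E ∖ F` (`#O = ρ(E) − q + 2`): every two outside points form a cocircuit
(`rk_sdiff_pair_of_long_flat`), and for every `x ∈ O` the set `O ∖ x` is independent (`rk_sdiff_erase_of_long_flat`)
and skew to `F` (`rk_clF_union_erase_of_long_flat`) — §37(b) at every co-rank.  (b) On a coloop-free matroid every
demanding rank-`(q−1)` set has closure excess `ρ(E ∖ B) − #(E ∖ cl B) ≤ q − 2` (`rk_sdiff_le_card_sdiff_clF_add_of_coloopFree`;
the crude `q − 1` of `thresholdSum_le_mul_add` sharpened by one), so `(I_t)` follows from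
`(q − 2) · #L_t ≤ Σ_{T_t} (q − d_t(S))` (`thresholdIneq_of_mul_card_le_of_coloopFree`).  (c) THE BOUNDARY FORM OF THE
SLACK: for `S ∈ T_t` with `ρ(E ∖ S) ≥ t + 1` every coloop of `S` is demanding (`filter_coloops_eq_of_succ_le`), and for
`ρ(E ∖ S) = t` exactly the coloops OUTSIDE `cl(E ∖ S)` are (`filter_coloops_eq_of_eq`); hence
`Σ_{T_t} (q − d_t(S)) = Σ_{T_t} (q − κ(S)) + Σ_{S ∈ T_t, ρ(E∖S) = t} #(coloops(S) ∩ cl(E ∖ S))`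
(`sum_slack_eq_add_boundary`) and the excess form of `(I_t)` reads `Σ_{L_t} ρ(E ∖ B) ≤ Σ_{L_t} #(E ∖ cl B) +
Σ_{T_t} (q − κ(S)) + Σ_{boundary} #(coloops(S) ∩ cl(E ∖ S))` (`thresholdIneq_iff_excess_boundary`).  Nothing open is
asserted.
-/

open scoped Matroid

namespace PercRepro.Cogirth

open Finset ThmH Skew Shadow Profile

variable {α : Type} [DecidableEq α] {N : Matroid α} [N.Finite]

section LongFlat

variable {q t : ℕ}

/-- **Outside a rank-`(q−1)` flat with `ν + q − 2` points, every two points form a cocircuit** (`2 ≤ q`, coloop-free):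
`#(cl B) + ρ(E) = #E + (q − 2)` and distinct `x, y ∉ cl B` give `ρ(E ∖ {x, y}) + 1 = ρ(E)`. -/
theorem rk_sdiff_pair_of_long_flat (hq : 2 ≤ q) (hcf : ∀ z ∈ gr N, rk N ((gr N).erase z) = rk N (gr N))
    {B : Finset α} (hB : B ∈ Rq N (q - 1)) (hlong : (clF N B).card + rk N (gr N) = (gr N).card + (q - 2))
    {x y : α} (hx : x ∈ gr N \ clF N B) (hy : y ∈ gr N \ clF N B) (hxy : x ≠ y) :
    rk N (gr N \ {x, y}) + 1 = rk N (gr N) := by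
  have hBrk : rk N B = q - 1 := rk_eq_of_eRk_eq_cq (mem_Rq.1 hB).2
  have hclg : clF N B ⊆ gr N := clF_subset_gr B
  have hpair : ({x, y} : Finset α) ⊆ gr N \ clF N B := insert_subset hx (singleton_subset_iff.2 hy)
  have hsub : gr N \ {x, y} ⊆ clF N B ∪ ((gr N \ clF N B) \ {x, y}) := by
    intro z hz
    rw [mem_sdiff] at hz
    by_cases hzcl : z ∈ clF N B
    · exact mem_union_left _ hzcl
    · exact mem_union_right _ (mem_sdiff.2 ⟨mem_sdiff.2 ⟨hz.1, hzcl⟩, hz.2⟩)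
  have h1 : rk N (gr N \ {x, y}) ≤ rk N (clF N B) + rk N ((gr N \ clF N B) \ {x, y}) :=
    (rk_mono' hsub).trans (rk_union_le _ _)
  have h2 : rk N ((gr N \ clF N B) \ {x, y}) ≤ ((gr N \ clF N B) \ {x, y}).card := rk_le_card _
  have h3 : ((gr N \ clF N B) \ {x, y}).card = (gr N \ clF N B).card - 2 := by
    rw [card_sdiff_of_subset hpair, card_pair hxy]
  have h4 : (gr N \ clF N B).card = (gr N).card - (clF N B).card := card_sdiff_of_subset hclg
  have h5 : (clF N B).card ≤ (gr N).card := card_le_card hclg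
  have hxg : x ∈ gr N := (mem_sdiff.1 hx).1
  have hyg : y ∈ gr N := (mem_sdiff.1 hy).1
  have heq : gr N \ {x, y} = ((gr N).erase x).erase y := by
    ext z
    simp only [mem_sdiff, mem_insert, mem_singleton, mem_erase, not_or]
    tauto
  have h6 : rk N ((gr N).erase x) ≤ rk N (((gr N).erase x).erase y) + 1 :=
    rk_le_rk_erase_add_one (erase_subset _ _) (mem_erase.2 ⟨hxy.symm, hyg⟩)
  rw [← heq] at h6
  rw [rk_clF, hBrk] at h1
  have h7 := hcf x hxg
  have h8 : 2 ≤ (gr N \ clF N B).card := card_le_card hpair |>.trans' (by rw [card_pair hxy])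
  omega

/-- **Outside a long rank-`(q−1)` flat, `O ∖ x` is independent**: `ρ((E ∖ cl B) ∖ x) + 1 = #(E ∖ cl B)` for
`x ∉ cl B` (`ρ(E) = ρ(E ∖ x) ≤ (q − 1) + ρ(O ∖ x)` against `#O = ρ(E) − q + 2`). -/
theorem rk_sdiff_erase_of_long_flat (hq : 2 ≤ q) (hcf : ∀ z ∈ gr N, rk N ((gr N).erase z) = rk N (gr N))
    {B : Finset α} (hB : B ∈ Rq N (q - 1)) (hlong : (clF N B).card + rk N (gr N) = (gr N).card + (q - 2))
    {x : α} (hx : x ∈ gr N \ clF N B) :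
    rk N ((gr N \ clF N B).erase x) + 1 = (gr N \ clF N B).card := by
  have hBrk : rk N B = q - 1 := rk_eq_of_eRk_eq_cq (mem_Rq.1 hB).2
  have hclg : clF N B ⊆ gr N := clF_subset_gr B
  have hsub : (gr N).erase x ⊆ clF N B ∪ ((gr N \ clF N B).erase x) := by
    intro y hy
    rw [mem_erase] at hy
    by_cases hycl : y ∈ clF N B
    · exact mem_union_left _ hycl
    · exact mem_union_right _ (mem_erase.2 ⟨hy.1, mem_sdiff.2 ⟨hy.2, hycl⟩⟩)
  have h1 : rk N ((gr N).erase x) ≤ rk N (clF N B) + rk N ((gr N \ clF N B).erase x) :=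
    (rk_mono' hsub).trans (rk_union_le _ _)
  have h2 : rk N ((gr N \ clF N B).erase x) ≤ ((gr N \ clF N B).erase x).card := rk_le_card _
  have h3 : ((gr N \ clF N B).erase x).card = (gr N \ clF N B).card - 1 := card_erase_of_mem hx
  have h4 : (gr N \ clF N B).card = (gr N).card - (clF N B).card := card_sdiff_of_subset hclg
  have h5 : (clF N B).card ≤ (gr N).card := card_le_card hclg
  have h6 : 0 < (gr N \ clF N B).card := card_pos.2 ⟨x, hx⟩
  rw [rk_clF, hBrk, hcf x (mem_sdiff.1 hx).1] at h1
  omega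

/-- **`O ∖ x` is skew to a long rank-`(q−1)` flat**: `ρ(cl B ∪ (O ∖ x)) = ρ(cl B) + ρ(O ∖ x)` (both sides are
`ρ(E) = (q − 1) + (#O − 1)`). -/
theorem rk_clF_union_erase_of_long_flat (hq : 2 ≤ q) (hcf : ∀ z ∈ gr N, rk N ((gr N).erase z) = rk N (gr N))
    {B : Finset α} (hB : B ∈ Rq N (q - 1)) (hlong : (clF N B).card + rk N (gr N) = (gr N).card + (q - 2))
    {x : α} (hx : x ∈ gr N \ clF N B) :
    rk N (clF N B ∪ (gr N \ clF N B).erase x) = rk N (clF N B) + rk N ((gr N \ clF N B).erase x) := by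
  have hBrk : rk N B = q - 1 := rk_eq_of_eRk_eq_cq (mem_Rq.1 hB).2
  have hclg : clF N B ⊆ gr N := clF_subset_gr B
  have h1 := rk_union_erase_of_long_line hcf B hx
  have h2 := rk_sdiff_erase_of_long_flat hq hcf hB hlong hx
  have h4 : (gr N \ clF N B).card = (gr N).card - (clF N B).card := card_sdiff_of_subset hclg
  have h5 : (clF N B).card ≤ (gr N).card := card_le_card hclg
  rw [h1, rk_clF, hBrk]
  omega

end LongFlat

section ExcessBound

variable {q t : ℕ}

/-- **The excess is at most `q − 2` on a coloop-free matroid** (`2 ≤ q`): a demanding rank-`(q−1)` set `B`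
(`q ≤ ρ(E ∖ B)`) has `ρ(E ∖ B) ≤ #(E ∖ cl B) + (q − 2)` — the flat `cl B` has at most `ν + q − 2` points, since
`ν + q − 1` points would make it the whole ground set (`clF_eq_gr_of_card_clF_add_rk_eq`) against `q ≤ ρ(E ∖ B) ≤ ρ(E)`. -/
theorem rk_sdiff_le_card_sdiff_clF_add_of_coloopFree (hq : 2 ≤ q)
    (hcf : ∀ z ∈ gr N, rk N ((gr N).erase z) = rk N (gr N)) {B : Finset α} (hB : B ∈ Rq N (q - 1))
    (ht : q ≤ rk N (gr N \ B)) : rk N (gr N \ B) ≤ (gr N \ clF N B).card + (q - 2) := by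
  have hBrk : rk N B = q - 1 := rk_eq_of_eRk_eq_cq (mem_Rq.1 hB).2
  have hclg : clF N B ⊆ gr N := clF_subset_gr B
  have hle := card_clF_add_rk_le_of_mem_Rq hB
  have h4 : (gr N \ clF N B).card = (gr N).card - (clF N B).card := card_sdiff_of_subset hclg
  have h5 : (clF N B).card ≤ (gr N).card := card_le_card hclg
  have hmono : rk N (gr N \ B) ≤ rk N (gr N) := rk_mono' sdiff_subset
  by_cases heq : (clF N B).card + rk N (gr N) = (gr N).card + (q - 1)
  · exfalso
    have hF := clF_eq_gr_of_card_clF_add_rk_eq hcf hB heq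
    have := rk_clF (M := N) B
    rw [hF, hBrk] at this
    omega
  · omega

/-- `thresholdSum N q t ≤ Σ_{L_t} #(E ∖ cl B) + (q − 2) · #L_t` on a coloop-free matroid at every offset `t ≥ q − 1`
(`2 ≤ q`). -/
theorem thresholdSum_le_add_mul_of_coloopFree (hq : 2 ≤ q) (hqt : q - 1 ≤ t)
    (hcf : ∀ z ∈ gr N, rk N ((gr N).erase z) = rk N (gr N)) :
    thresholdSum N q t ≤
      ∑ B ∈ (Rq N (q - 1)).filter (fun B => t + 1 ≤ rk N (gr N \ B)), (gr N \ clF N B).card +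
        (q - 2) * ((Rq N (q - 1)).filter (fun B => t + 1 ≤ rk N (gr N \ B))).card := by
  have hR : ∑ B ∈ (Rq N (q - 1)).filter (fun B => t + 1 ≤ rk N (gr N \ B)), (gr N \ clF N B).card +
      (q - 2) * ((Rq N (q - 1)).filter (fun B => t + 1 ≤ rk N (gr N \ B))).card =
      ∑ B ∈ (Rq N (q - 1)).filter (fun B => t + 1 ≤ rk N (gr N \ B)), ((gr N \ clF N B).card + (q - 2)) := by
    rw [sum_add_distrib, sum_const, smul_eq_mul, mul_comm]
  rw [thresholdSum_eq_sum_filter, hR]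
  apply sum_le_sum
  intro B hB
  rw [mem_filter] at hB
  exact rk_sdiff_le_card_sdiff_clF_add_of_coloopFree hq hcf hB.1 (by omega)

/-- **`(I_t)` on a coloop-free matroid from `(q − 2) · #L_t ≤ Σ_{T_t} (q − d_t(S))`** (`2 ≤ q`, `q − 1 ≤ t`): the excess
form with the uniform excess bound `q − 2`. -/
theorem thresholdIneq_of_mul_card_le_of_coloopFree (hq : 2 ≤ q) (hqt : q - 1 ≤ t)
    (hcf : ∀ z ∈ gr N, rk N ((gr N).erase z) = rk N (gr N))
    (h : (q - 2) * ((Rq N (q - 1)).filter (fun B => t + 1 ≤ rk N (gr N \ B))).card ≤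
      ∑ S ∈ levelSetCoQ N t q,
        (q - ((coloops N S).filter
          (fun y => S.erase y ∈ (Rq N (q - 1)).filter (fun B => t + 1 ≤ rk N (gr N \ B)))).card)) :
    ThresholdIneq N q t := by
  rw [thresholdIneq_iff_excess (by omega), ← thresholdSum_eq_sum_filter]
  exact (thresholdSum_le_add_mul_of_coloopFree hq hqt hcf).trans (by omega)

end ExcessBound

section Boundary

variable {q t : ℕ}

/-- The complement of `S ∖ y` is the complement of `S` with `y` put back (`y ∈ S ⊆ E`). -/
theorem sdiff_erase_eq_insert_sdiff {S : Finset α} (hS : S ⊆ gr N) {y : α} (hy : y ∈ S) :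
    gr N \ S.erase y = insert y (gr N \ S) := by
  ext z
  simp only [mem_sdiff, mem_erase, mem_insert, not_and]
  constructor
  · rintro ⟨hz, h⟩
    by_cases hzy : z = y
    · exact Or.inl hzy
    · exact Or.inr ⟨hz, fun hzS => h (fun h' => hzy h') hzS⟩
  · rintro (rfl | ⟨hz, hzS⟩)
    · exact ⟨hS hy, fun h _ => h rfl⟩
    · exact ⟨hz, fun _ h => hzS h⟩

/-- A coloop's deletion is a rank-`(q−1)` subset of `E` (`S ∈ T_t`, `1 ≤ q`). -/
theorem erase_mem_Rq_of_mem_coloops {S : Finset α} (hS : S ∈ levelSetCoQ N t q) (hq : 1 ≤ q)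
    {y : α} (hy : y ∈ coloops N S) : S.erase y ∈ Rq N (q - 1) := by
  obtain ⟨⟨hSg, hSr⟩, _⟩ := mem_levelSetCoQ.1 hS
  have hSrk : rk N S = q := rk_eq_of_eRk_eq_cq hSr
  have h := rk_erase_of_mem_coloops hSg hy
  rw [mem_Rq]
  refine ⟨(erase_subset y S).trans hSg, ?_⟩
  rw [← coe_rk]
  congr 1
  omega

/-- **Interior targets**: for `S ∈ T_t` with `ρ(E ∖ S) ≥ t + 1` every coloop of `S` is demanding, `d_t(S) = κ(S)`
(`1 ≤ q`). -/
theorem filter_coloops_eq_of_succ_le {S : Finset α} (hS : S ∈ levelSetCoQ N t q) (hq : 1 ≤ q)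
    (h : t + 1 ≤ rk N (gr N \ S)) :
    (coloops N S).filter
      (fun y => S.erase y ∈ (Rq N (q - 1)).filter (fun B => t + 1 ≤ rk N (gr N \ B))) = coloops N S := by
  apply filter_true_of_mem
  intro y hy
  rw [mem_filter]
  refine ⟨erase_mem_Rq_of_mem_coloops hS hq hy, ?_⟩
  exact h.trans (rk_mono' (sdiff_subset_sdiff (Subset.refl _) (erase_subset y S)))

/-- **Boundary targets**: for `S ∈ T_t` with `ρ(E ∖ S) = t` a coloop of `S` is demanding iff it lies outside
`cl(E ∖ S)`, `d_t(S) = #(coloops(S) ∖ cl(E ∖ S))` (`1 ≤ q`). -/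
theorem filter_coloops_eq_of_eq {S : Finset α} (hS : S ∈ levelSetCoQ N t q) (hq : 1 ≤ q)
    (h : rk N (gr N \ S) = t) :
    (coloops N S).filter
      (fun y => S.erase y ∈ (Rq N (q - 1)).filter (fun B => t + 1 ≤ rk N (gr N \ B))) =
      coloops N S \ clF N (gr N \ S) := by
  obtain ⟨⟨hSg, _⟩, _⟩ := mem_levelSetCoQ.1 hS
  ext y
  rw [mem_filter, mem_sdiff, mem_filter]
  constructor
  · rintro ⟨hy, _, hyt⟩
    refine ⟨hy, fun hycl => ?_⟩
    have hyS : y ∈ S := (mem_coloops.1 hy).1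
    rw [sdiff_erase_eq_insert_sdiff hSg hyS, rk_insert_eq (hSg hyS) sdiff_subset, if_pos hycl, h] at hyt
    omega
  · rintro ⟨hy, hycl⟩
    have hyS : y ∈ S := (mem_coloops.1 hy).1
    refine ⟨hy, erase_mem_Rq_of_mem_coloops hS hq hy, ?_⟩
    rw [sdiff_erase_eq_insert_sdiff hSg hyS, rk_insert_eq (hSg hyS) sdiff_subset, if_neg hycl, h]

/-- **THE BOUNDARY FORM OF THE SLACK** (`1 ≤ q`):
`Σ_{S∈T_t} (q − d_t(S)) = Σ_{S∈T_t} (q − κ(S)) + Σ_{S∈T_t, ρ(E∖S) = t} #(coloops(S) ∩ cl(E ∖ S))` — the interior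
targets contribute their dependency slack `q − κ(S)` only, the boundary targets in addition their coloops in the
closure of the complement. -/
theorem sum_slack_eq_add_boundary (N : Matroid α) [N.Finite] (q t : ℕ) (hq : 1 ≤ q) :
    ∑ S ∈ levelSetCoQ N t q,
        (q - ((coloops N S).filter
          (fun y => S.erase y ∈ (Rq N (q - 1)).filter (fun B => t + 1 ≤ rk N (gr N \ B)))).card) =
      ∑ S ∈ levelSetCoQ N t q, (q - (coloops N S).card) +
        ∑ S ∈ (levelSetCoQ N t q).filter (fun S => rk N (gr N \ S) = t),
          (coloops N S ∩ clF N (gr N \ S)).card := by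
  rw [sum_filter, ← sum_add_distrib]
  apply sum_congr rfl
  intro S hS
  obtain ⟨⟨hSg, hSr⟩, hSt⟩ := mem_levelSetCoQ.1 hS
  have hSrk : rk N S = q := rk_eq_of_eRk_eq_cq hSr
  have hκ : (coloops N S).card ≤ q := hSrk ▸ card_coloops_le_rk hSg
  by_cases h : rk N (gr N \ S) = t
  · rw [if_pos h, filter_coloops_eq_of_eq hS hq h]
    have hsplit := card_sdiff_add_card_inter (coloops N S) (clF N (gr N \ S))
    omega
  · rw [if_neg h, filter_coloops_eq_of_succ_le hS hq (by omega)]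
    omega

/-- **THE EXCESS FORM OF `(I_t)`, BOUNDARY VERSION** (`1 ≤ q`): `(I_t)` iff
`Σ_{L_t} ρ(E ∖ B) ≤ Σ_{L_t} #(E ∖ cl B) + Σ_{T_t} (q − κ(S)) + Σ_{S∈T_t, ρ(E∖S) = t} #(coloops(S) ∩ cl(E ∖ S))`. -/
theorem thresholdIneq_iff_excess_boundary (hq : 1 ≤ q) :
    ThresholdIneq N q t ↔
      ∑ B ∈ (Rq N (q - 1)).filter (fun B => t + 1 ≤ rk N (gr N \ B)), rk N (gr N \ B) ≤
        ∑ B ∈ (Rq N (q - 1)).filter (fun B => t + 1 ≤ rk N (gr N \ B)), (gr N \ clF N B).card +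
          (∑ S ∈ levelSetCoQ N t q, (q - (coloops N S).card) +
            ∑ S ∈ (levelSetCoQ N t q).filter (fun S => rk N (gr N \ S) = t),
              (coloops N S ∩ clF N (gr N \ S)).card) := by
  rw [thresholdIneq_iff_excess hq, sum_slack_eq_add_boundary N q t hq]

end Boundary

end PercRepro.Cogirth
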